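import Summits.AtomisticToContinuum.BoseEinsteinCondensation.Theorems.InfraredMinimumUncertainty.Negative.FreeDensityWave

/-!
# Negative lemmas for crux `HardCoreExtension` (stmt-AtomisticToContinuum-11786) — line
# `third-law-current-floor`, stub S1 `stub_secondMomentFloor`, I: two-body plane waves on `cell²`
# (finite Parseval) and the partial derivatives of `X ↦ e_p(x_j)` along `k = (2π/L)e₀`

Supports (does not close) stmt-AtomisticToContinuum-11786 (route `BECConjugateDomination`); drefute
seat on the picked line `Cruxes/HardCoreExtension/Lines/third-law-current-floor.lean`.

Stub S1 is the exact second-moment floor `((n+1)K)² ≤ ((n+1)S)(4D + (n+1)K²(2 − S))` for every REAL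
periodic `C¹` Bose state (`K = |k|²`, `S` the structure-factor integral, `D` the force-structure
integral), i.e. Cauchy–Schwarz applied to `Re⟨ρ_kΨ, [H,ρ_k]Ψ⟩ = (n+1)K` and
`‖[H,ρ_k]Ψ‖² = 4D + (n+1)K²(2−S)`; both identities use `Ψ∇Ψ = ∇(Ψ²)/2`.  Here:

* File I (this file) is the TOOLKIT for the refutation in file II (`SecondMomentFloorReality`):
  `biWave` (two-body plane waves `e_p(x₀)e_q(x₁)`), `integral_cellN_two_biWave` (orthogonality),
  `integral_norm_sq_sum_biWave` (**finite Parseval on `cell²`**: `∫|∑ᵢ aᵢ e_{pᵢ}⊗e_{qᵢ}|² = L⁶∑ᵢ|aᵢ|²`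
  for distinct bi-momenta), `kvec` (`k = (2π/L)e₀`, `norm_kvec`, `sum_mul_kvec`), `cellWaveProjDeriv` /
  `hasFDerivAt_cellWave_proj` / `cellWaveProjDeriv_apply_single` (**`∂_{(i,w)} e_p(x_j) =
  [i = j] e_p(x_j)(2πi/L)(p·w)`** on `Config 2`).
-/

noncomputable section

open MeasureTheory Filter Set
open scoped ENNReal NNReal Topology ComplexConjugate BigOperators

namespace Summit.AtomisticToContinuum.BoseEinsteinCondensation.Theorems.HardCoreExtension.Negative

open Literature.MathematicalPhysics.QuantumManyBody.BoseGas
open Summit.AtomisticToContinuum.BoseEinsteinCondensation.Theorems.GaussianDominationCan.Negative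
  (integral_cellN_prod integral_cell_const)
open Summit.AtomisticToContinuum.BoseEinsteinCondensation.Theorems.CorrectorClosure.Negative
  (e0 e0_ne_zero)

variable {L : ℝ}

/-! ## Two-body plane waves on `cell²` and a finite Parseval identity -/

/-- The two-body plane wave `e_p(x₀) e_q(x₁)` on `Config 2`. -/
def biWave (L : ℝ) (p q : Fin 3 → ℤ) (X : Config 2) : ℂ :=
  cellWave L p (X 0) * cellWave L q (X 1)

/-- `e_p(x₀)e_q(x₁)` is continuous. [folklore] -/
@[fun_prop]
theorem continuous_biWave (L : ℝ) (p q : Fin 3 → ℤ) : Continuous (biWave L p q) := by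
  unfold biWave; fun_prop

/-- `∫_cell e_p = L³·[p = 0]`. [folklore] -/
theorem integral_cell_cellWave_ite (hL : 0 < L) (p : Fin 3 → ℤ) :
    ∫ x in cell L, cellWave L p x = if p = 0 then ((L : ℂ) ^ 3) else 0 := by
  split_ifs with hp
  · subst hp
    simp_rw [cellWave_zero]
    rw [integral_cell_const hL, mul_one]
  · exact integral_cell_cellWave_eq_zero hL hp

/-- **Orthogonality**: `∫_{cell²} e_p(x₀)e_q(x₁) = L³[p = 0] · L³[q = 0]`. [folklore] -/
theorem integral_cellN_two_biWave (hL : 0 < L) (p q : Fin 3 → ℤ) :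
    ∫ X in cellN 2 L, biWave L p q X =
      (if p = 0 then ((L : ℂ) ^ 3) else 0) * (if q = 0 then ((L : ℂ) ^ 3) else 0) := by
  have h := integral_cellN_prod (L := L) (N := 2) ![cellWave L p, cellWave L q]
  simp only [Fin.prod_univ_two, Matrix.cons_val_zero, Matrix.cons_val_one] at h
  unfold biWave
  rw [h, integral_cell_cellWave_ite hL, integral_cell_cellWave_ite hL]

/-- `conj(e_p(x₀)e_q(x₁)) · e_{p'}(x₀)e_{q'}(x₁) = e_{−p+p'}(x₀) e_{−q+q'}(x₁)`. [folklore] -/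
theorem conj_biWave_mul_biWave (L : ℝ) (p q p' q' : Fin 3 → ℤ) (X : Config 2) :
    conj (biWave L p q X) * biWave L p' q' X = biWave L (-p + p') (-q + q') X := by
  unfold biWave
  rw [map_mul, conj_cellWave, conj_cellWave, cellWave_add_index, cellWave_add_index]
  ring

/-- **Finite Parseval on `cell²`**: for pairwise distinct two-body momenta,
`∫_{cell²} |∑ᵢ aᵢ e_{pᵢ}(x₀)e_{qᵢ}(x₁)|² = L⁶ ∑ᵢ |aᵢ|²`. [folklore] -/
theorem integral_norm_sq_sum_biWave (hL : 0 < L) {ι : Type*} [Fintype ι] [DecidableEq ι]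
    (a : ι → ℂ) (P : ι → (Fin 3 → ℤ) × (Fin 3 → ℤ)) (hP : Function.Injective P) :
    ∫ X in cellN 2 L, ‖∑ i, a i * biWave L (P i).1 (P i).2 X‖ ^ 2 = L ^ 6 * ∑ i, ‖a i‖ ^ 2 := by
  obtain ⟨F, hF⟩ : ∃ F : Config 2 → ℂ, F = fun X => ∑ i, a i * biWave L (P i).1 (P i).2 X :=
    ⟨_, rfl⟩
  have hFX : ∀ X, (∑ i, a i * biWave L (P i).1 (P i).2 X) = F X := fun X => by rw [hF]
  simp_rw [hFX]
  have hFc : Continuous F := by rw [hF]; fun_prop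
  -- `‖F‖² = Re(conj F · F)`
  have hpt : ∀ X, ‖F X‖ ^ 2 = (conj (F X) * F X).re := fun X => by
    rw [Complex.conj_mul']
    norm_cast
  simp_rw [hpt]
  have hint : Integrable (fun X => conj (F X) * F X) (volume.restrict (cellN 2 L)) :=
    integrableOn_cellN (hFc.star.mul hFc) L
  rw [show (∫ X in cellN 2 L, (conj (F X) * F X).re) = (∫ X in cellN 2 L, conj (F X) * F X).re from
    integral_re hint]
  -- expand the double sum and integrate term by term
  have hprod : ∀ X, conj (F X) * F X =
      ∑ i, ∑ j, conj (a i) * a j * biWave L (-(P i).1 + (P j).1) (-(P i).2 + (P j).2) X := by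
    intro X
    simp only [hF, map_sum, map_mul, Finset.sum_mul_sum]
    refine Finset.sum_congr rfl fun i _ => Finset.sum_congr rfl fun j _ => ?_
    rw [← conj_biWave_mul_biWave]
    ring
  simp_rw [hprod]
  have hterm : ∀ i j, ∫ X in cellN 2 L,
      conj (a i) * a j * biWave L (-(P i).1 + (P j).1) (-(P i).2 + (P j).2) X =
        if i = j then conj (a i) * a i * (L : ℂ) ^ 6 else 0 := by
    intro i j
    rw [integral_const_mul, integral_cellN_two_biWave hL]
    by_cases hij : i = j
    · subst hij
      simp only [neg_add_cancel, if_true]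
      ring
    · have hne : P i ≠ P j := fun h => hij (hP h)
      rw [if_neg hij]
      rcases ne_or_eq (-(P i).1 + (P j).1) 0 with h1 | h1
      · rw [if_neg h1]; ring
      · have h2 : -(P i).2 + (P j).2 ≠ 0 := fun h2 =>
          hne (Prod.ext (neg_add_eq_zero.mp h1) (neg_add_eq_zero.mp h2))
        rw [if_neg h2]; ring
  rw [integral_finsetSum _ fun i _ => ?_]
  · have hinner : ∀ i, ∫ X in cellN 2 L, ∑ j,
        conj (a i) * a j * biWave L (-(P i).1 + (P j).1) (-(P i).2 + (P j).2) X =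
          conj (a i) * a i * (L : ℂ) ^ 6 := by
      intro i
      rw [integral_finsetSum _ fun j _ => ?_]
      · simp_rw [hterm i]
        rw [Finset.sum_ite_eq Finset.univ i]
        simp
      · exact integrableOn_cellN (by fun_prop) L
    simp_rw [hinner]
    rw [Complex.re_sum, Finset.mul_sum]
    refine Finset.sum_congr rfl fun i _ => ?_
    rw [Complex.conj_mul']
    norm_cast
    ring
  · exact integrableOn_cellN (by fun_prop) L


/-! ## Partial derivatives of `X ↦ e_p(x_j)` on `Config 2`, along `k = (2π/L)e₀` -/

/-- The wave vector `k = (2π/L)e₀` (the line's `(2π/L) • latticeVec 1 m` at `m = e₀`). -/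
def kvec (L : ℝ) : Space := (2 * Real.pi / L) • latticeVec 1 e0

/-- The coordinates of `k`. [folklore] -/
theorem kvec_apply (L : ℝ) (k : Fin 3) : kvec L k = 2 * Real.pi / L * (e0 k : ℝ) := by
  simp [kvec, latticeVec]

/-- `‖k‖ = 2π/L`. [folklore] -/
theorem norm_kvec (hL : 0 < L) : ‖kvec L‖ = 2 * Real.pi / L := by
  unfold kvec
  rw [norm_smul, Real.norm_of_nonneg (by positivity)]
  have : ‖latticeVec 1 e0‖ = 1 := by
    rw [EuclideanSpace.norm_eq, Fin.sum_univ_three]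
    simp [latticeVec, e0, Pi.single_apply]
  rw [this, mul_one]

/-- `p · k = (2π/L) p₀`. [folklore] -/
theorem sum_mul_kvec (L : ℝ) (p : Fin 3 → ℤ) :
    (∑ k : Fin 3, (p k : ℝ) * kvec L k) = 2 * Real.pi / L * (p 0 : ℝ) := by
  simp only [kvec_apply, Fin.sum_univ_three, e0, Pi.single_eq_same, Pi.single_eq_of_ne one_ne_zero,
    Pi.single_eq_of_ne (show (2 : Fin 3) ≠ 0 by decide)]
  push_cast
  ring

/-- The derivative of `X ↦ e_p(x_j)` at `X` (chain rule through the projection `X ↦ x_j`). -/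
def cellWaveProjDeriv (L : ℝ) (p : Fin 3 → ℤ) (j : Fin 2) (X : Config 2) : Config 2 →L[ℝ] ℂ :=
  (cellWave L p (X j) • ((2 * Real.pi * Complex.I / L) •
    (Complex.ofRealCLM.comp (∑ k : Fin 3, (p k : ℝ) • PiLp.proj (𝕜 := ℝ) 2 (fun _ : Fin 3 => ℝ) k)))).comp
    (ContinuousLinearMap.proj j)

/-- `X ↦ e_p(x_j)` is differentiable with derivative `cellWaveProjDeriv`. [folklore] -/
theorem hasFDerivAt_cellWave_proj (L : ℝ) (p : Fin 3 → ℤ) (j : Fin 2) (X : Config 2) :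
    HasFDerivAt (fun Y : Config 2 => cellWave L p (Y j)) (cellWaveProjDeriv L p j X) X := by
  unfold cellWaveProjDeriv
  exact (hasFDerivAt_cellWave L p (X j)).comp X (hasFDerivAt_apply (𝕜 := ℝ) j X)

/-- **Partial derivatives of `X ↦ e_p(x_j)`**: `∂_{(i,w)} e_p(x_j) = [i = j] e_p(x_j) (2πi/L)(p·w)`.
[folklore] -/
theorem cellWaveProjDeriv_apply_single (L : ℝ) (p : Fin 3 → ℤ) (j i : Fin 2) (X : Config 2)
    (w : Space) :
    cellWaveProjDeriv L p j X (Pi.single i w) =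
      if i = j then cellWave L p (X j) *
        ((2 * Real.pi * Complex.I / L) * ((∑ k : Fin 3, (p k : ℝ) * w k : ℝ) : ℂ)) else 0 := by
  unfold cellWaveProjDeriv
  rw [ContinuousLinearMap.comp_apply, ContinuousLinearMap.proj_apply]
  split_ifs with h
  · subst h
    rw [Pi.single_eq_same, smul_apply, smul_apply, ← sum_coord_eq_clm, smul_eq_mul, smul_eq_mul]
  · rw [Pi.single_eq_of_ne (fun e => h e.symm), map_zero]


end Summit.AtomisticToContinuum.BoseEinsteinCondensation.Theorems.HardCoreExtension.Negative
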